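import Mathlib
import Summits.Ventures.FusionMHD.Models.CerfonFreidbergIterLikeQ25Defs
import HarnessLib

/-!
# Ventures/FusionMHD — Models/CerfonFreidbergIterLikeQ25Panels1.lean: KERNEL CHECK of panels 0, 1 (of 32) of the
# certified safety factor `q(ψ_N = 1/4)/F` of THE Cerfon–Freidberg ITER-like instance (sibling of `…IterLikeQHalfPanels*.lean`)

HONEST FRAMING (LADDER-GRIDFUSION three columns; CF rung, F2 item R2, q-profile sample).  One `decide +kernel` (≈ 86 s on the farm): for
each panel `j` listed, the per-panel obligation `CFIterLike.Q25.PanelCert.ok` (`Models/CerfonFreidbergIterLikeQ25Defs.lean`) — the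
Taylor-model run of `CFIterLike.Q25.progG` over the ITER-like parameter box is ACCEPTED (every `log`/`sin`/`cos` composition and the `inv`
certificate), and the kernel's panel-integral enclosure of the polar `(6.35)` integrand along the approximant, the range of the flux residual
`U(ray m) − 3U_a/4`, the range of the approximant `m` and the range of the radial derivative `D_r(θ, m)` lie inside the integers claimed in
`panelCert1` (values read off a compiled `#eval` of the same functions, slack one unit of `2⁻⁶⁰`; probe `QProbeIF*.lean`, generator
`pub/gridfusion/models/gen-model-5/g8/gen90/mkdefsN.py`).  What these Booleans MEAN (real-number statements, uniformly over the parameter box ∋ THE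
ITER-like instance) is proved once in `Models/CerfonFreidbergIterLikeQ25Sound.lean`.  MODELLED: analytic Cerfon–Freidberg family; `q` of a
MODEL surface — nothing about a device or stability.  No `native_decide`.  Typer/prover: gridfusion-model-5 (g8), 2026-08-27.
Citations: Freidberg 2014 §6.3.5 (6.35) [Freidberg2014]; Mahboubi–Melquiond–Sibut-Pinote 2016 §3.2 Lemma 3 [MahboubiMelquiondSibutpinote2016].
-/

namespace Summit.Ventures.FusionMHD.Models.CFIterLike.Q25

/-- The certificate data of panels 0, 1 (`ψ_N = 1/4`): `inv` candidate (degree-12 fit of `(X·D_r)⁻¹` in the panel variable, scaled by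
`2⁶⁰`), Taylor degree, `inv` widening `2^elog2`, and the claimed integral / residual / `m`-range / `D_r`-range integers (× `2⁶⁰`). [instance data] -/
def panelCert1 : List PanelCert := [
  { j := 0, cand := [7183167707346179072, 574829364069110912, 18424696935053885440, 1931842228721188608, 31051622515109658624, 5457795073271703552, 58755752927773048832, 111022288464995008512, 1391890912124420751360, -364525399081659660238848, -4430713769168174770552832, 509770459112302065295032320, 4918037749357386578538790912],
    deg := 12, elog2 := 37, plo := 101985837530397821, phi := 101985842246559092, eta := 415134430, mlo := 166343042012170983, mhi := 166983605194057812,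
    dlo := 155265642962601868, dhi := 155785027678090575 },
  { j := 1, cand := [7219212779710227456, 1735859828986646528, 18790274036367077376, 5903343688278471680, 32792713800636280832, 17018814476544811008, 66566386084752269312, 88374260579187556352, -7489420276180233224192, -126787854925339708882944, 25833519889950730996416512, 122514216079685056731283456, -33378971498853267509004468224],
    deg := 12, elog2 := 37, plo := 103024513110979228, phi := 103024517849480895, eta := 408185224, mlo := 166767163534176940, mhi := 168269989699004569,
    dlo := 154231282951883838, dhi := 155437248317050935 }]

/-- **KERNEL CHECK** of panels 0, 1 of the ITER-like surface `ψ_N = 1/4`. -/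
theorem panelCert1_ok : CFIterLike.Q25.panelCert1.all PanelCert.ok = true := by
  decide +kernel

end Summit.Ventures.FusionMHD.Models.CFIterLike.Q25
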